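import Literature.Geometry.Lorentzian.KerrPointwiseDecay
import Literature.Geometry.Lorentzian.KerrHyperboloidalLeaves
import HarnessLib

/-!
# DRSR Corollary 3.1 (30) through `Σ̃_τ(h♯_{R₁})` from the energy decay estimates and a
# Gagliardo–Nirenberg inequality on the leaves: the assembly of the pointwise decay rate `τ^{-3/2+δ}`

(statement group **gr.S24**; namespace `Literature.Geometry.Lorentzian.Kerr`, glue in
`Literature.Geometry.Lorentzian`)

This file is the next layer of the decomposition of the named fact
`Literature.Geometry.Lorentzian.drsr_wave_pointwise_decay_kerr` (`KerrWaveDecay.lean`;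
Dafermos–Rodnianski–Shlapentokh-Rothman, arXiv:1402.7034 = Ann. of Math. 183 (2016), "DRSR",
Cor. 3.1, estimate (30)). The layer above it is in the tree: `KerrPointwiseDecay.lean` reduces that
fact to — and shows it equivalent to — the **leaf form** of (30): the estimate
`sup_{Σ̃_τ ∩ {r₊ < r ≤ R}} |ψ| ≤ C τ^{-3/2+δ}` for the concrete foliation
`Σ̃_τ(h♯_{R₁}) = {t*_KS = τ + h♯_{R₁}(y)}` (`Kerr.scriHeight`) by hyperboloidal leaves terminating at
`𝓘⁺` which coincide with the Kerr–Schild slices on `{r ≤ R₁}`, and the data class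
`Kerr.HasBallData R₁` (smooth solutions with data supported in `{‖y‖ ≤ R₁}`; `ψ_∞ = 0`)
(`drsr_wave_pointwise_decay_kerr_of_corollary_3_1_scri_pointwise` and its converse
`Kerr.scri_leaf_pointwise_decay_of_drsr_wave_pointwise_decay_kerr` there; the leaf form was first
vendored as a named fact of its own, `Kerr.drsr_corollary_3_1_scri_pointwise_decay`, and merged back
into `drsr_wave_pointwise_decay_kerr` by the D-0026 review of that decomposition, being the same
statement up to elementary bookkeeping; here it is written out as the conclusion of the assembly
theorem). DRSR
prove Cor. 3.1 by invoking the "black box" of Dafermos–Rodnianski (arXiv:0910.4957; "see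
[Schlue] and [Moschidis] for detailed treatments", §3.3). For the **pointwise** estimate (30) the
black box is spelled out by Moschidis (arXiv:1509.08489, §9.4, for `d = 3`): writing `φ` for the
solution and `{t̄ = τ}` for the hyperboloidal leaves,

* (E1) `∫_{t̄=τ} (|∇_{h_{τ,N}} φ|²_{h} + r⁻² |Tφ|²) dh_N ≲ τ⁻² E` — first-order energy decay
  (his Thm. 8.1; on Kerr the first estimate of DRSR Cor. 3.1, `∫_{Σ̃_τ} J^N[ψ] n ≤ C E τ⁻²`);
* (E2) `Σ_{i₁+i₂=1} ∫_{t̄=τ} (|∇^{i₁+1}_{h}(T^{i₂}φ)|²_{h} + r⁻² |T²φ|²) dh_N ≲ τ^{-4+ε} E` — the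
  improved decay of the second-order energy (his Thm. 9.1 with `q = 2`, obtained from the decay of
  the energy of `Tφ` and the elliptic estimates of his App.; on Kerr the second estimate of DRSR
  Cor. 3.1, `∫_{Σ̃_τ ∩ {r ≤ R}} J^N[Nψ] n ≤ C E τ^{-4+2δ}`, is its local part);
* (GN) the Gagliardo–Nirenberg inequality on the leaves (his Lemma 9.10, `d = 3`):
  `sup_{t̄=τ} |φ|² ≲ (E1-integral)^{1/2} (E2-integral)^{1/2} + (E2-integral)`, valid for functions
  with `r|φ|, r|∇φ| = O(1)` along the leaf (finite radiation field);

whence `sup |φ|² ≲ τ⁻¹ τ^{-2+δ} + τ^{-4+2δ} ≲ τ^{-3+2δ}`, i.e. (30). Here `h_{τ,N}` is the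
Riemannian metric on the leaf whose inverse is `g⁻¹` restricted to the annihilator of the timelike
field `N` (arXiv:1509.08489, §10.1; `dvol_g = √(−g(N,N)) dt̄ ∧ dvol_{h}`), so that the energy flux
`J^N_μ n^μ dσ` through the leaf is `≈ |∇_{h}φ|²_{h} dh_N` plus the degenerate transversal term.

This file renders (E1), (E2), (GN) on the prelude's objects and **proves** the assembly:

* `Kerr.leafFun M a h ψ τ : E3 → ℝ` — the leaf function `Ψ_τ(y) = ψ̃(τ + h(y), y)` of a wave `ψ` on
  the exterior chart, in the Cartesian parametrisation `y ∈ E3` of the leaf `Σ̃_τ(h)` (zero off the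
  exterior; `leafFun_apply_of_mem`); `Kerr.leafGradEnergy` (the (E1)-quantity
  `∫_S (‖DΨ_τ‖² + ‖y‖⁻² (TΨ)_τ²) dy` over the slice region `S = {y : r(0, y) > r₊}`) and
  `Kerr.leafHessEnergy` (the (E2)-quantity `∫_S (‖D²Ψ_τ‖² + ‖D(TΨ)_τ‖² + ‖y‖⁻² (T²Ψ)_τ²) dy`,
  `T = timeDeriv`), see *The Cartesian rendering* below;
* `Kerr.leafFun_contDiffAt`, `Kerr.leafFun_contDiffOn` (**proved**): `Ψ_τ` is smooth on `S` for
  the heights `h♯_{R₁}`, `R₁ > r₊` (composition of the smooth extension with the smooth graph map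
  `y ↦ (τ + h♯_{R₁}(y), y)`, `Kerr.contDiffAt_scriHeight`);
* hypothesis **(D)** of the assembly theorem (*not* a named fact, see below): for the foliation
  `Σ̃_τ(h♯_{R₁})` and the data class `HasBallData R₁`: (D1) `leafGradEnergy ≤ C τ⁻²`, (D2)
  `leafHessEnergy ≤ C_δ τ^{-4+2δ}` for every `δ > 0`, (D3) on each leaf `‖y‖ |Ψ_τ|` and
  `‖y‖ ‖DΨ_τ‖` are bounded (`τ ≥ 1`) — DRSR Cor. 3.1, estimates 1–3, with the upgrade of
  Moschidis Thms. 7.1, 8.1, 9.1 (derivation from print in *The two analytic inputs* below);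
* hypothesis **(GN)** of the assembly theorem (*not* a named fact): the inequality of Moschidis
  Lemma 9.10 (`d = 3`) on the exterior `S` of the horizon ellipsoid in `E3`, in Cartesian form —
  Agmon's inequality `‖u‖²_∞ ≲ ‖∇u‖₂ ‖D²u‖₂ + r₊ ‖D²u‖₂²` on an exterior domain (classical);
* `Kerr.drsr_corollary_3_1_scri_pointwise_decay_of_leafEnergy_decay` (**proved**): (D) → (GN) →
  the leaf form of (30) for `Σ̃_τ(h♯_{R₁})`: at an exterior leaf point,
  `ψ(p)² = Ψ_τ(y)² ≤ C_GN (√(C₁τ⁻²) √(C_δ τ^{-4+2δ}) + C_δ τ^{-4+2δ}) ≤ K τ^{-3+2δ}` with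
  `K = C_GN (√C₁ √C_δ + C_δ)` (`sqrt_mul_sqrt_add_le_rpow`), so `|ψ(p)| ≤ √K τ^{-3/2+δ}`; hence
  `Literature.Geometry.Lorentzian.drsr_wave_pointwise_decay_kerr_of_leafEnergy_decay` (compose with
  `KerrPointwiseDecay.lean`): **given the printed energy-decay estimates (D) and the classical
  interpolation inequality (GN), the gr.S24 pointwise decay fact follows**, the real-variable and
  bookkeeping part of Moschidis' §9.4 being proved here.

**Why (D) and (GN) are hypotheses and not named facts (D-0026).** This file is written from the
proving seat of `drsr_wave_pointwise_decay_kerr`, which may not add unproved named facts to the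
tree; the two inputs are therefore spelled out as explicit hypotheses of the two assembly
theorems (statement-schema style, as `stationary_black_hole_uniqueness` in `BlackHoles.lean`),
with their derivation from the printed sources recorded below. A literature seat for
Moschidis 2016 (Lemma 9.10; Thms. 7.1, 8.1, 9.1 on Kerr) may vendor them verbatim as named facts —
or prove (GN) —, after which the assembly applies by `exact … hD hGN`.

## The Cartesian rendering of (E1), (E2), (GN)

The leaves `Σ̃_τ(h)` are graphs over the slice region `S ⊆ E3` (`Kerr.slice a r₊`; `y ↦ (τ + h y, y)`
is a diffeomorphism onto the exterior part of the leaf, and `r(τ + h y, y) = r(0, y)`,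
`Kerr.radius_ofTimeSpace`), so functions on the leaf are functions on `S` and we measure them with
the Euclidean structure of `E3 ⊇ S` and Lebesgue measure `dy`. This is uniformly equivalent to
Moschidis' `(h_{τ,N}, dh_N)`: (a) in the coordinates `(t̃, y)`, `t̃ = t* − h(y)`, the components
`g⁻¹(dyⁱ, dyʲ) = δ^{ij} − 2H ℓⁱℓʲ` are those of the Kerr–Schild chart, so where `N = T = ∂_{t̃}`
(`r ≥ r₁`) `h_{τ,N}⁻¹ = δ − 2H ℓ⃗ ⊗ ℓ⃗`, eigenvalues `1, 1, 1 − 2H ∈ [1 − 2M/r₁, 1]`, and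
`dh_N = dy / √(1 − 2H)` (`dvol_g = dt* dy = dt̃ dy`, `det g = −1`); (b) on `{r ≤ R₁}`, where the leaf
is the Kerr–Schild slice and `N` is any `φ_τ`-invariant timelike field (e.g. `V = −g♯dt*`,
`g(V, V) = −1 − 2H ≤ −1` up to and on `𝓗⁺`), `h_{τ,N}⁻¹ = g⁻¹|_{ann N}` transported to `T*S` is a
smooth positive-definite matrix in the `dyⁱ`, continuous up to `𝓗⁺`, hence uniformly equivalent to
`δ` on `{r₊ < r ≤ R₁}`, and `dh_N = √(1 + 2H) dy ∈ [1, √3] dy` there (`H ≤ 1` on the subextremal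
exterior, `Kerr.scalarH_le_one`); (c) covariant `h`-Hessians and Cartesian second derivatives differ
by `Γ(h) · DΨ` with `|Γ| ≤ C(M, a)(1 + r)⁻²`, a first-order term controlled on `{r ≥ R}` by the
Cartesian Hardy inequality `∫_{S} ‖y‖⁻² ‖DΨ‖² ≤ 4 ∫_S ‖D²Ψ‖²` (radial integration from infinity,
boundary term of the right sign, `‖y‖ ‖DΨ‖² → 0`) and on `{r ≤ R}` by the local first-order energy,
which decays like `τ^{-4+2δ}` (DRSR Cor. 3.1 (31); Moschidis Cor. 9.2); (d) the weight: `r⁻²` and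
`‖y‖⁻²` agree up to constants on `S` (`r ≤ ‖y‖ ≤ √(r² + a²)`, `r > r₊ > 0`), and the multiplier `N`
of `|Nφ|`, `|N²φ|` is replaced by `T = ∂_{t*}` (`timeDeriv`): `N = T` for `r ≥ r₁`, and on the compact
range `{r ≤ r₁}` `Tφ = Nφ + (T − N)φ` with `T − N` smooth and `φ_τ`-invariant, so the difference is
bounded by first and second derivatives of `φ` there, again controlled by (E2) and the local energy.
With these identifications each of (D1), (D2), and the hypotheses/conclusion of (GN) is implied by
the printed statement it cites with constants depending on `(M, a, R₁)`; the existential constants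
absorb them. None of (a)–(d) is formalised: they are the content of the section *The two analytic
inputs* below, exactly as the `V`-versus-`N` comparabilities in `KerrHyperboloidalFlux.lean` and
`KerrDecayHierarchy.lean`.

## Design choices

* **Concrete energies, two inputs.** As in `KerrDecayHierarchy.lean`, the deep input (energy decay)
  and the elementary input are separated along *concrete* quantities (`leafGradEnergy`,
  `leafHessEnergy`, the weighted sup bounds), so that each hypothesis is independently meaningful and
  the classical one (GN) can later be *proved* (Agmon's inequality on the exterior of a convex body:
  reflection across `∂S` or radial integration from infinity, plus the flat inequality
  `‖u‖_{L^∞(ℝ³)} ≤ C ‖∇u‖₂^{1/2} ‖D²u‖₂^{1/2}`, the first display in the proof of Lemma 9.10 of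
  arXiv:1509.08489). Mathlib has the
  Gagliardo–Nirenberg–Sobolev inequality `MeasureTheory.eLpNorm_le_eLpNorm_fderiv_of_eq` but not
  Agmon's `L^∞` interpolation; nothing here duplicates Mathlib. Likewise (D1) is, up to a pointwise
  coercivity computation for the flux density `T[ψ](V, W)` through the leaves
  (`≥ c(M, a, R₁) (‖DΨ_τ‖² + ‖y‖⁻²(Tψ)²)`, the analogue for the asymptotically null leaves of
  `Kerr.coordEnergyDensity_le_four_mul_stressEnergy`), a consequence of the vendored flux estimate
  `Kerr.drsr_corollary_3_1_scri_flux_decay`; that computation is not carried out here.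
* **Why the whole leaf.** A Sobolev or interpolation inequality on the bounded region
  `{‖y‖ ≤ R}` alone cannot give the rate `3/2`: its lower-order terms are controlled only by the
  first-order energy (`τ⁻²`). The multiplicative inequality on the whole (unbounded) leaf, where decay
  at infinity replaces lower-order terms, is essential — hence the a priori decay clause (D3)
  (`‖y‖|Ψ_τ|`, `‖y‖‖DΨ_τ‖` bounded on each leaf: DRSR Cor. 3.1, third estimate
  `sup_{Σ̃_τ} r|ψ − ψ_∞| ≤ C √E τ^{-1/2}`, and the finite radiation field of Moschidis Thm. 7.1).
* **Norms.** `‖DΨ‖` is the operator norm of `fderiv ℝ Ψ y : E3 →L[ℝ] ℝ` (the Euclidean length of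
  the gradient) and `‖D²Ψ‖` that of `fderiv ℝ (fderiv ℝ Ψ) y` (between `1/√3` and `1` times the
  Hilbert–Schmidt norm `(Σ_{ij} (∂ᵢ∂ⱼΨ)²)^{1/2}` of the printed `|∇²φ|²`); constants absorb the
  difference. Integrals are `ℝ≥0∞`-valued Lebesgue integrals over `S`; (D1)–(D2) bound them by
  `ENNReal.ofReal (C τ^{…})`, which makes them finite, and (GN) is stated for finite integrals in
  real form (`ENNReal.toReal`, `Real.sqrt`).
* **`R₀ > r₊`.** The threshold of (D) is taken `> r₊` (an equivalent normalisation, the property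
  being monotone in `R₀`), so that `h♯_{R₁}` is smooth on `S` (`Kerr.contDiffAt_scriHeight`) and
  `Ψ_τ` is smooth there (`leafFun_contDiffOn`), as (GN) — stated, as printed, for smooth functions —
  requires.
* Binders use `Kerr.region a (Kerr.rPlus M a)` for `Kerr.exterior M a` and
  `(Kerr.slice a (Kerr.rPlus M a) : Set E3)` for `S` (`Kerr.ofTimeSpace_mem_region_iff`).

## References

* M. Dafermos, I. Rodnianski, Y. Shlapentokh-Rothman, *Decay for solutions of the wave equation
  on Kerr exterior spacetimes III: the full subextremal case `|a| < M`*, Ann. of Math. 183 (2016)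
  787–913, arXiv:1402.7034: §3.3, Cor. 3.1 (the five estimates; (30), (31)), §3.4, §4.1, Thm. 3.1
  footnote on `N` (key `DafermosRodnianskiShlapentokhrothman2014`).
* G. Moschidis, *The `r^p`-weighted energy method of Dafermos and Rodnianski in general
  asymptotically flat spacetimes and applications*, Ann. PDE 2 (2016), arXiv:1509.08489: §1.3.3
  (Kerr, restatement of DRSR Cor. 3.1: `∫_{Σ̃_τ} J^N(Nφ) n ≤ C E τ^{-4+δ}`,
  `sup_{Σ̃_τ} |φ| ≤ C √E τ^{-3/2}`), Thm. 7.1 (radiation field), Thm. 8.1, §9.2 (the norms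
  `𝓔_en^{(p,q,m)}`), Thm. 9.1 (`𝓔_en^{(0,q,m)}(τ) ≲ τ^{-2q+C_m ε} 𝓔_bound(0)`), Cor. 9.2, §9.4
  (sketch: (E1), (E2), (GN)), §9.8 Lemma 9.10 and its proof (first display: the flat inequality
  `‖f‖_∞ ≤ C ‖f‖^{1/2}_{Ḣ^{(d-1)/2}} ‖f‖^{1/2}_{Ḣ^{(d+1)/2}}`), §10.1 (`h_{τ,N}`) (key `Moschidis2016`).
* C. Foias, O. Manley, R. Rosa, R. Temam, *Navier–Stokes equations and turbulence*, CUP (2001),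
  Ch. II, App. A, (A.29) (Agmon's inequality `|u|_{L^∞} ≤ c ‖u‖^{1/2} |Au|^{1/2}` in three
  dimensions) (key `FoiasManleyRosaTemam2001`).
-/

noncomputable section

open Set Filter TopologicalSpace MeasureTheory
open scoped Topology ENNReal Manifold ContDiff

namespace Literature.Geometry.Lorentzian

namespace Kerr

/-! ### Leaf functions and their Cartesian energies -/

/-- The **leaf function** `Ψ_τ : E3 → ℝ` of a function `ψ` on the exterior chart along the leaf
`Σ̃_τ(h) = {t* = τ + h(y)}`: `Ψ_τ(y) = ψ̃(τ + h(y), y)`, `ψ̃` the extension of `ψ` by zero (so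
`Ψ_τ(y) = ψ(leafPoint h τ y)` whenever the leaf point lies in the exterior, i.e. `y ∈ S = {r(0,y) >
r₊}`, and `0` otherwise). This is `ψ|_{Σ̃_τ}` in the Cartesian parametrisation `y` of the leaf
(DRSR arXiv:1402.7034, §3.3; Moschidis arXiv:1509.08489, §9.8: functions on `S_{τ,r₀}`). [cite: DafermosRodnianskiShlapentokhrothman2014, §3.3] -/
def leafFun (M a : ℝ) (h : E3 → ℝ) (ψ : region a (rPlus M a) → ℝ) (τ : ℝ) : E3 → ℝ :=
  fun y ↦ Function.extend Subtype.val ψ 0 (leafPoint h τ y)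

/-- At a leaf point of the exterior the leaf function is the value of `ψ`. [folklore] -/
theorem leafFun_apply_of_mem {M a : ℝ} (h : E3 → ℝ) (ψ : region a (rPlus M a) → ℝ) (τ : ℝ)
    {y : E3} (hy : leafPoint h τ y ∈ region a (rPlus M a)) :
    leafFun M a h ψ τ y = ψ ⟨leafPoint h τ y, hy⟩ :=
  (extend_rep ψ ⟨leafPoint h τ y, hy⟩).symm

/-- The leaf function of the zero field vanishes. [folklore] -/
theorem leafFun_zero (M a : ℝ) (h : E3 → ℝ) (τ : ℝ) :
    leafFun M a h (fun _ : region a (rPlus M a) ↦ (0 : ℝ)) τ = fun _ ↦ 0 := by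
  funext y
  by_cases hy : leafPoint h τ y ∈ region a (rPlus M a)
  · rw [leafFun_apply_of_mem h _ τ hy]
  · unfold leafFun
    rw [Function.extend_apply' _ _ _ (fun ⟨x, hx⟩ ↦ hy (hx ▸ x.2))]
    simp

/-- The **first-order Cartesian leaf energy** (the (E1)-quantity of the module docstring):
`A(τ) = ∫_S (‖DΨ_τ(y)‖² + ‖y‖⁻² ((TΨ)_τ(y))²) dy` over the slice region `S = {r(0, y) > r₊}`,
`Ψ_τ = leafFun … ψ τ`, `(TΨ)_τ = leafFun … (timeDeriv ψ) τ`. Up to constants `C(M, a, R₁)` this is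
Moschidis' `∫_{t̄=τ} (|∇_{h_{τ,N}}φ|²_h + r⁻²|Tφ|²) dh_N` (arXiv:1509.08489, Thm. 8.1 and §9.4),
comparable to the flux `∫_{Σ̃_τ} J^N_μ[ψ] n^μ` of DRSR Cor. 3.1 (module docstring, *The Cartesian
rendering*). `ℝ≥0∞`-valued. [cite: Moschidis2016, §9.4] -/
def leafGradEnergy (M a : ℝ) (h : E3 → ℝ) (ψ : region a (rPlus M a) → ℝ) (τ : ℝ) : ℝ≥0∞ :=
  ∫⁻ y in (slice a (rPlus M a) : Set E3),
    ENNReal.ofReal (‖fderiv ℝ (leafFun M a h ψ τ) y‖ ^ 2 +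
      ‖y‖⁻¹ ^ 2 * (leafFun M a h (timeDeriv ψ) τ y) ^ 2)

/-- The **second-order Cartesian leaf energy** (the (E2)-quantity of the module docstring):
`B(τ) = ∫_S (‖D²Ψ_τ‖² + ‖D(TΨ)_τ‖² + ‖y‖⁻² ((T²Ψ)_τ)²) dy`, i.e. Moschidis'
`Σ_{i₁+i₂=1} ∫_{t̄=τ} (|∇^{i₁+1}_{h}(T^{i₂}φ)|²_h + r⁻²|T²φ|²) dh_N` (arXiv:1509.08489, §9.4
(eq. EnergyDecaySketch); the `j = 0` part of `𝓔_en^{(0,2,m)}` of §9.2) in Cartesian form.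
`ℝ≥0∞`-valued. [cite: Moschidis2016, §9.2–§9.4] -/
def leafHessEnergy (M a : ℝ) (h : E3 → ℝ) (ψ : region a (rPlus M a) → ℝ) (τ : ℝ) : ℝ≥0∞ :=
  ∫⁻ y in (slice a (rPlus M a) : Set E3),
    ENNReal.ofReal (‖fderiv ℝ (fderiv ℝ (leafFun M a h ψ τ)) y‖ ^ 2 +
      ‖fderiv ℝ (leafFun M a h (timeDeriv ψ) τ) y‖ ^ 2 +
      ‖y‖⁻¹ ^ 2 * (leafFun M a h (timeDeriv (timeDeriv ψ)) τ y) ^ 2)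

/-! ### Smoothness of the leaf functions -/

/-- The graph map `y ↦ (τ + h(y), y)` written with the time axis split off. [folklore] -/
theorem leafPoint_eq_smul_add (h : E3 → ℝ) (τ : ℝ) (y : E3) :
    leafPoint h τ y = (τ + h y) • E4.basisVector 0 + E4.ofTimeSpace 0 y := by
  unfold leafPoint
  ext μ
  refine Fin.cases ?_ (fun i ↦ ?_) μ
  · simp [E4.ofTimeSpace_apply_zero, E4.basisVector]
  · simp [E4.ofTimeSpace_apply_succ, E4.basisVector, Fin.succ_ne_zero]

/-- **The leaf functions along `Σ̃_τ(h♯_{R₁})` are smooth on the slice region**: at `y ∈ S`,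
`Ψ_τ = ψ̃ ∘ (y ↦ (τ + h♯_{R₁}(y), y))` is `C^∞`, as the composition of the extension of the smooth
`ψ` (smooth at exterior points, `contDiffAt_extend`) with the smooth graph map
(`Kerr.contDiffAt_scriHeight`, `R₁ > r₊`). [folklore] -/
theorem leafFun_contDiffAt {M a R₁ : ℝ} (hMa : IsSubextremal M a)
    (hR₁ : rPlus M a < R₁) {ψ : region a (rPlus M a) → ℝ}
    (hψ : ContMDiff 𝓘(ℝ, E4) 𝓘(ℝ, ℝ) ∞ ψ) (τ : ℝ) {y : E3}
    (hy : y ∈ (slice a (rPlus M a) : Set E3)) :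
    ContDiffAt ℝ ∞ (leafFun M a (scriHeight M a R₁) ψ τ) y := by
  have hmem : leafPoint (scriHeight M a R₁) τ y ∈ region a (rPlus M a) :=
    ofTimeSpace_mem_region_iff.2 hy
  have hleaf : ContDiffAt ℝ ∞ (leafPoint (scriHeight M a R₁) τ) y := by
    have heq : leafPoint (scriHeight M a R₁) τ =
        fun y ↦ (τ + scriHeight M a R₁ y) • E4.basisVector 0 + E4.ofTimeSpace 0 y :=
      funext (leafPoint_eq_smul_add _ τ)
    rw [heq]
    exact ((contDiffAt_const.add (contDiffAt_scriHeight hMa hR₁ ⟨y, hy⟩)).smul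
      contDiffAt_const).add (E4.contDiff_ofTimeSpace 0).contDiffAt
  exact (contDiffAt_extend hψ ⟨_, hmem⟩).comp y hleaf

/-- `Ψ_τ` is smooth on the slice region `S` (the regularity hypothesis of (GN) in
`drsr_corollary_3_1_scri_pointwise_decay_of_leafEnergy_decay`). [folklore] -/
theorem leafFun_contDiffOn {M a R₁ : ℝ} (hMa : IsSubextremal M a)
    (hR₁ : rPlus M a < R₁) {ψ : region a (rPlus M a) → ℝ}
    (hψ : ContMDiff 𝓘(ℝ, E4) 𝓘(ℝ, ℝ) ∞ ψ) (τ : ℝ) :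
    ContDiffOn ℝ ∞ (leafFun M a (scriHeight M a R₁) ψ τ) (slice a (rPlus M a) : Set E3) :=
  fun _ hy ↦ (leafFun_contDiffAt hMa hR₁ hψ τ hy).contDiffWithinAt

/-! ### The two analytic inputs of the assembly, hypotheses (D) and (GN)

**(D).** **Dafermos–Rodnianski–Shlapentokh-Rothman, Corollary 3.1, energy estimates 1–3, through the
foliation `Σ̃_τ(h♯_{R₁})`, with the second-order upgrade of Moschidis** — hypothesis **(D)** of the
assembly theorems (the energy-level input behind the pointwise estimate (30)). As printed (arXiv:1402.7034 = Ann. of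
Math. 183 (2016), §3.3, Cor. 3.1): for `a₀, M, a, δ` as in Thms. 3.1–3.2, `R > r₊`, `Σ̃₀`
asymptotically hyperboloidal terminating at null infinity, `Σ̃_τ = φ_τ(Σ̃₀)`, sufficiently regular
solutions of `□_g ψ = 0` satisfy `∫_{Σ̃_τ} J^N_μ[ψ] n^μ ≤ C(a₀, M) E τ⁻²`,
`∫_{Σ̃_τ ∩ {r ≤ R}} J^N_μ[Nψ] n^μ ≤ C(a₀, M, δ, R) E τ^{-4+2δ}`, `sup_{Σ̃_τ} r|ψ − ψ_∞| ≤ C(a₀, M) √E τ^{-1/2}`,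
`E` an appropriate higher-order weighted energy of the data; in the detailed treatment these are
Moschidis' Thm. 8.1 (`∫_{t̄=τ} (|∇_{h_{τ,N}}φ|²_h + r⁻²|Tφ|²) dh_N ≲ τ⁻² 𝓔(0)`) and Thm. 9.1 with
`d = 3`, `q = 2` (`𝓔_en^{(0,2,m)}(τ) ≲_{m,ε} τ^{-4+C_m ε} 𝓔_bound^{(4,2,m+…)}(0)`, whose `j = 0` part is
`Σ_{i₁+i₂=1} ∫_{t̄=τ} (|∇^{i₁+1}_h (N^{i₂}φ)|²_h + r₊⁻²|N²φ|²) dh_N`; arXiv:1509.08489, §9.2, §9.4,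
and §1.3.3: "(M_{a,M}, g_{a,M}) satisfies all the geometric assumptions of Theorems …; by applying
Theorems 8.1 and 9.1 one can readily upgrade [DRSR's boundedness and integrated decay] to …
Corollary 3.1", where the whole-leaf bound `∫_{Σ̃_τ} J^N(Nφ) n ≤ C E τ^{-4+δ}` is printed), both
"provided [the finiteness condition on the weighted initial energies `𝓔_in` of Thm. 7.1] holds",
which for data of compact support it does, Thm. 7.1 then giving a radiation field
`Φ_{𝓘⁺} = lim rφ` with finite limits `lim r^{j₁}∂_v^{j₁}∂_σ^{j₂}∂_u^{j₃}(rφ)` along the leaves.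
**Hypothesis (D), Cartesian form.** For `|a| < M` there is `R₀ = R₀(M, a) > r₊` such that for every `R₁ ≥ R₀` and
every admissible wave `ψ` (`IsAdmissibleKerrWave`) with data supported in `{‖y‖ ≤ R₁}`
(`HasBallData`), writing `Ψ_τ = leafFun M a (scriHeight M a R₁) ψ τ` for the leaf functions along
`Σ̃_τ(h♯_{R₁})` and `S = {r(0, y) > r₊} ⊆ E3`:
(D1) there is `C` with `leafGradEnergy … ψ τ ≤ C τ⁻²` for `τ ≥ 1` — the first estimate (Thm. 8.1);
(D2) for every `δ > 0` there is `C_δ` with `leafHessEnergy … ψ τ ≤ C_δ τ^{-4+2δ}` for `τ ≥ 1` — the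
second estimate in Moschidis' whole-leaf, second-order form (Thm. 9.1, `q = 2`, loss `C_m ε ↦ 2δ`);
(D3) for every `τ ≥ 1` there is `C₀` with `‖y‖ |Ψ_τ(y)| ≤ C₀` and `‖y‖ ‖DΨ_τ(y)‖ ≤ C₀` on `S` — the
third estimate (`r|ψ| ≤ C √E τ^{-1/2} ≤ C √E`, `ψ_∞ = 0`) and, for the gradient, the finite
radiation field far out (Thm. 7.1: along the leaf, which terminates at `𝓘⁺`,
`∂_vφ, r⁻¹∂_σφ = O(r⁻²)`, while `∂_uφ = O(r⁻¹)` enters `DΨ_τ` only with the factor `du/dr = O(r⁻²)`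
of the leaf, `Kerr.outgoingNullSlope_sub_scriSlope_le`) together with, on the compact part
`{r ≤ R}`, the smoothness of `ψ` up to and across `𝓗⁺` ((ii) below; quantitatively (31)).
Derivation of the Cartesian form from the printed one: (i)–(ii) as for the leaf form of (30) in
`KerrPointwiseDecay.lean` (`Σ̃₀(h♯_{R₁})` is admissible of the second kind for
`R₁ ≥ R₀`; the induced data are smooth, compactly supported, `E < ∞`, `ψ_∞ = 0`, `ψ` sufficiently
regular on `D⁺(Σ̃₀)`); (iii) the identifications (a)–(d) of the module docstring, *The Cartesian
rendering* (`h_{τ,N} ≃ δ` and `dh_N ≃ dy` uniformly on `S` with constants `C(M, a, R₁)`; `r⁻² ≃ ‖y‖⁻²`;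
`N ↦ T = ∂_{t*}` at the cost of first- and second-order terms on `{r ≤ r₁}`; covariant versus
Cartesian Hessian at the cost of `∫ |Γ|²‖DΨ‖²`, bounded far out by the Hardy inequality
`∫_S ‖y‖⁻²‖DΨ‖² ≤ 4∫_S ‖D²Ψ‖²` and near by the local first-order energy, which decays like
`τ^{-4+2δ}` by (31)/Cor. 9.2); (iv) multiplier `N` versus `V`, `T` as in the footnote to DRSR
Thm. 3.1; (v) on `[1, τ₀]`, were the estimates read for `τ ≥ τ₀` only, boundedness (Thm. 3.2 (28)
with §3.3, `j ≤ 3`) applies. Hypothesis (D) asserts less than the sources (existential,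
`ψ`-dependent constants; one foliation; compactly supported data). Instance hypotheses
`[Kerr.Facts] [Kerr.SliceFacts]` supply the Kerr metric and its Levi-Civita connection. Sources:
DafermosRodnianskiShlapentokhrothman2014, Cor. 3.1 (estimates 1–3) with §3.3; Moschidis2016,
Thm. 7.1, Thm. 8.1, Thm. 9.1 (`q = 2`), §9.4, §1.3.3.

**(GN).** **Gagliardo–Nirenberg (Agmon) interpolation inequality on the exterior of the horizon
ellipsoid in `E3`** — hypothesis **(GN)** of the assembly theorems (classical). As printed (Moschidis, arXiv:1509.08489,
§9.8, Lemma 9.10, `d = 3`, the leaves `S_{τ,r₀} = {t̄ = τ} ∩ {r ≥ r₀}`): for smooth `ψ` on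
`S_{τ,r₀}` with `r |∇^l_{h_{τ,N}} ψ| = O(1)` as `r → ∞` for `l ≤ 1`,
`sup_{S_{τ,r₀}} |ψ|² ≤ C ((∫ |∇_h ψ|²_h dh_N)^{1/2} (∫ |∇²_h ψ|²_h dh_N)^{1/2} + ∫ |∇²_h ψ|²_h dh_N)`;
proved there from the flat inequality `‖f‖_{L^∞(ℝ³)} ≤ C ‖f‖^{1/2}_{Ḣ¹} ‖f‖^{1/2}_{Ḣ²}` (first display
of the proof; in three dimensions this is Agmon's inequality, Foias–Manley–Rosa–Temam 2001, Ch. II,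
(A.29)) applied to `χ_{R₀}ψ` (cut-off to `{r ≥ R₀}`, where `(r, σ)` is a diffeomorphism onto the
complement of a ball), the Sobolev and Poincaré inequalities on the compact part `{r ≤ 2R₀}`, the
Hardy inequalities of his Lemma 12.3 for the first-order Leibniz terms and the "critical" Hardy
inequality of his Lemma 12.4 for the annular zeroth-order term `∫_{R₀ ≤ r ≤ 2R₀} |ψ|²`, so that only
`(∫|∇ψ|²)^{1/2}(∫|∇²ψ|²)^{1/2} + ∫|∇²ψ|²` remains on the right (§9.8, displays following the lemma). **Hypothesis (GN), Cartesian form**, for the region `S = {y ∈ E3 : r(0, y) > r₊}` — the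
exterior of the solid ellipsoid `{(y₁² + y₂²)/(r₊² + a²) + y₃²/r₊² ≤ 1}`, which is convex and contains
`0`, so that `S` is the union of the outward rays from its points — parametrising every leaf
`Σ̃_τ(h)` (module docstring, *The Cartesian rendering*: `h_{τ,N} ≃ δ`, `dh_N ≃ dy`): for `|a| < M`
there is `C = C(M, a) ≥ 0` such that for every `Φ : E3 → ℝ` smooth (`C^∞`) on `S` (as printed) with
`‖y‖ |Φ(y)| ≤ C₀` and `‖y‖ ‖DΦ(y)‖ ≤ C₀` on `S` for some `C₀` (the hypothesis `l ≤ 1` of the lemma)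
and with `I₁ = ∫_S ‖DΦ‖² dy`, `I₂ = ∫_S ‖D²Φ‖² dy` finite,
`Φ(y)² ≤ C (√I₁ √I₂ + I₂)` for all `y ∈ S` (`‖DΦ‖`, `‖D²Φ‖` the operator norms of `fderiv ℝ Φ y`
and `fderiv ℝ (fderiv ℝ Φ) y`). A classical inequality, not in Mathlib; a candidate for a future
proof (Agmon on `ℝ³` by the frequency splitting `∫_{|ξ|≤Λ} |f̂| + ∫_{|ξ|>Λ} |f̂|`; on `S`, along each
outward ray `Φ(ρω)² ≤ 2∫_ρ^∞ |Φ||∂_sΦ| ds ≤ 8 (∫_ρ^∞ s²(∂_sΦ)²)^{1/2} (∫_ρ^∞ s²(∂²_sΦ)²)^{1/2}` by the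
two Hardy inequalities `∫_ρ^∞ f² ≤ 4∫_ρ^∞ s² f'²`, whose boundary terms at `s = ρ` have the
favourable sign, and the angular supremum is then controlled through the spheres `{r = c}`; the
lower-order terms arising at the scale `r₊` of `∂S` are the content of Moschidis' Lemma 12.4). The
multiplicative form without a first-order term `∫‖DΦ‖²` on the right is essential: with
`I₁ ≲ τ⁻²`, `I₂ ≲ τ^{-4+2δ}` it yields `τ^{-3+2δ}`, whereas any additive `I₁` would only give `τ⁻²`.
Sources: Moschidis2016, Lemma 9.10 (`d = 3`); FoiasManleyRosaTemam2001, Ch. II (A.29).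
-/

/-! ### The assembly: (30) for `Σ̃_τ(h♯_{R₁})` from (D) and (GN) -/

section assembly

/-- `√(τ^p) = τ^{p/2}` for `τ ≥ 0`. [folklore] -/
theorem sqrt_rpow_eq_rpow_div_two {τ : ℝ} (hτ : 0 ≤ τ) (p : ℝ) :
    Real.sqrt (τ ^ p) = τ ^ (p / 2) := by
  rw [Real.sqrt_eq_rpow, ← Real.rpow_mul hτ]
  congr 1
  ring

/-- Exponent bookkeeping for `τ ≥ 1`: `√(c₁ τ⁻²) √(c₂ τ^{-4+2δ}) + c₂ τ^{-4+2δ} ≤ (√c₁ √c₂ + c₂) τ^{-3+2δ}`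
(`c₁, c₂ ≥ 0`, `δ > 0`). [folklore] -/
theorem sqrt_mul_sqrt_add_le_rpow {c₁ c₂ δ τ : ℝ} (hc₁ : 0 ≤ c₁) (hc₂ : 0 ≤ c₂) (hδ : 0 < δ)
    (hτ : 1 ≤ τ) :
    Real.sqrt (c₁ * τ ^ (-2 : ℝ)) * Real.sqrt (c₂ * τ ^ (-4 + 2 * δ)) + c₂ * τ ^ (-4 + 2 * δ) ≤
      (Real.sqrt c₁ * Real.sqrt c₂ + c₂) * τ ^ (-3 + 2 * δ) := by
  have hτ0 : 0 ≤ τ := zero_le_one.trans hτ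
  have h1 : Real.sqrt (c₁ * τ ^ (-2 : ℝ)) = Real.sqrt c₁ * τ ^ (-1 : ℝ) := by
    rw [Real.sqrt_mul hc₁, sqrt_rpow_eq_rpow_div_two hτ0]
    norm_num
  have h2 : Real.sqrt (c₂ * τ ^ (-4 + 2 * δ)) = Real.sqrt c₂ * τ ^ (-2 + δ) := by
    rw [Real.sqrt_mul hc₂, sqrt_rpow_eq_rpow_div_two hτ0]
    congr 2
    ring
  have h3 : τ ^ (-1 : ℝ) * τ ^ (-2 + δ) = τ ^ (-3 + δ) := by
    rw [← Real.rpow_add (zero_lt_one.trans_le hτ)]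
    congr 1
    ring
  have h4 : τ ^ (-3 + δ) ≤ τ ^ (-3 + 2 * δ) :=
    Real.rpow_le_rpow_of_exponent_le hτ (by linarith)
  have h5 : τ ^ (-4 + 2 * δ) ≤ τ ^ (-3 + 2 * δ) :=
    Real.rpow_le_rpow_of_exponent_le hτ (by linarith)
  have hs : 0 ≤ Real.sqrt c₁ * Real.sqrt c₂ := mul_nonneg (Real.sqrt_nonneg _) (Real.sqrt_nonneg _)
  calc Real.sqrt (c₁ * τ ^ (-2 : ℝ)) * Real.sqrt (c₂ * τ ^ (-4 + 2 * δ)) + c₂ * τ ^ (-4 + 2 * δ)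
      = Real.sqrt c₁ * Real.sqrt c₂ * τ ^ (-3 + δ) + c₂ * τ ^ (-4 + 2 * δ) := by
        rw [h1, h2, ← h3]; ring
    _ ≤ Real.sqrt c₁ * Real.sqrt c₂ * τ ^ (-3 + 2 * δ) + c₂ * τ ^ (-3 + 2 * δ) := by
        gcongr
    _ = (Real.sqrt c₁ * Real.sqrt c₂ + c₂) * τ ^ (-3 + 2 * δ) := by ring

/-- `√(K τ^{-3+2δ}) = √K τ^{-3/2+δ}` for `τ ≥ 0`, `K ≥ 0`. [folklore] -/
theorem sqrt_mul_rpow_eq {K δ τ : ℝ} (hK : 0 ≤ K) (hτ : 0 ≤ τ) :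
    Real.sqrt (K * τ ^ (-3 + 2 * δ)) = Real.sqrt K * τ ^ (-(3 / 2 : ℝ) + δ) := by
  rw [Real.sqrt_mul hK, sqrt_rpow_eq_rpow_div_two hτ]
  congr 2
  ring

/-- An `ℝ≥0∞` quantity below `ENNReal.ofReal (C τ^p)` is, as a real number, below `max C 0 · τ^p`
(`τ ≥ 0`). [folklore] -/
theorem toReal_le_max_mul_rpow {x : ℝ≥0∞} {C τ p : ℝ} (hτ : 0 ≤ τ)
    (h : x ≤ ENNReal.ofReal (C * τ ^ p)) : x.toReal ≤ max C 0 * τ ^ p := by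
  have hfin : x ≠ ⊤ := ne_top_of_le_ne_top ENNReal.ofReal_ne_top h
  have h1 : x.toReal ≤ (ENNReal.ofReal (C * τ ^ p)).toReal := ENNReal.toReal_mono ENNReal.ofReal_ne_top h
  refine h1.trans ?_
  rw [ENNReal.toReal_ofReal']
  refine max_le ?_ (mul_nonneg (le_max_right _ _) (Real.rpow_nonneg hτ _))
  exact mul_le_mul_of_nonneg_right (le_max_left _ _) (Real.rpow_nonneg hτ _)

/-- The integral of `‖DΨ_τ‖²` over `S` is at most the first-order leaf energy. [folklore] -/
theorem lintegral_fderiv_sq_le_leafGradEnergy (M a : ℝ) (h : E3 → ℝ)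
    (ψ : region a (rPlus M a) → ℝ) (τ : ℝ) :
    (∫⁻ y in (slice a (rPlus M a) : Set E3),
        ENNReal.ofReal (‖fderiv ℝ (leafFun M a h ψ τ) y‖ ^ 2)) ≤ leafGradEnergy M a h ψ τ :=
  lintegral_mono fun _ ↦ ENNReal.ofReal_le_ofReal (le_add_of_nonneg_right (by positivity))

/-- The integral of `‖D²Ψ_τ‖²` over `S` is at most the second-order leaf energy. [folklore] -/
theorem lintegral_fderiv_fderiv_sq_le_leafHessEnergy (M a : ℝ) (h : E3 → ℝ)
    (ψ : region a (rPlus M a) → ℝ) (τ : ℝ) :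
    (∫⁻ y in (slice a (rPlus M a) : Set E3),
        ENNReal.ofReal (‖fderiv ℝ (fderiv ℝ (leafFun M a h ψ τ)) y‖ ^ 2)) ≤
      leafHessEnergy M a h ψ τ :=
  lintegral_mono fun _ ↦ ENNReal.ofReal_le_ofReal (by rw [add_assoc]; exact le_add_of_nonneg_right (by positivity))

/-- **DRSR Corollary 3.1 (30) for the foliation `Σ̃_τ(h♯_{R₁})` from the energy decay estimates and
the Gagliardo–Nirenberg inequality on the leaves.** The hypotheses (D) (`hD`: energy decay
through the leaves `Σ̃_τ(h♯_{R₁})`, DRSR Cor. 3.1 estimates 1–3 with Moschidis Thms. 7.1, 8.1, 9.1)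
and (GN) (`hGN`: Moschidis Lemma 9.10 on `S`), documented in the section above, imply the leaf
form of (30) — `sup_{Σ̃_τ(h♯_{R₁}) ∩ {r₊ < r ≤ R}} |ψ| ≤ C τ^{-3/2+δ}`, `τ ≥ 1`, for admissible waves
with ball data, written out as the conclusion (it is equivalent to the gr.S24 named fact
`Literature.Geometry.Lorentzian.drsr_wave_pointwise_decay_kerr`, `KerrPointwiseDecay.lean`) —: this
is the argument of Moschidis,
arXiv:1509.08489, §9.4 (proof of Cor. 9.2 from Thms. 8.1, 9.1 and Lemma 9.10) run on the concrete
quantities — for `τ ≥ 1` and a leaf point `p = (τ + h♯_{R₁}(y), y)` of the exterior,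
`ψ(p)² = Ψ_τ(y)² ≤ C_GN (√I₁ √I₂ + I₂)` with `I₁ ≤ leafGradEnergy ≤ C₁ τ⁻²` and
`I₂ ≤ leafHessEnergy ≤ C_δ τ^{-4+2δ}` ((D1), (D2); the hypotheses of (GN) are `leafFun_contDiffOn`
and (D3)), hence `ψ(p)² ≤ C_GN (√C₁ √C_δ + C_δ) τ^{-3+2δ}` (`sqrt_mul_sqrt_add_le_rpow`) and
`|ψ(p)| ≤ √K τ^{-3/2+δ}`. The threshold radius is that of (D). [cite: Moschidis2016, §9.4 (Cor. 9.2); DafermosRodnianskiShlapentokhrothman2014 §3.3 Cor. 3.1 (30)] -/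
theorem drsr_corollary_3_1_scri_pointwise_decay_of_leafEnergy_decay
    (hD : ∀ [Facts] [SliceFacts] (M a : ℝ), IsSubextremal M a →
        ∃ R₀ : ℝ, rPlus M a < R₀ ∧ ∀ R₁ : ℝ, R₀ ≤ R₁ →
          ∀ ψ : region a (rPlus M a) → ℝ, Literature.Geometry.Lorentzian.IsAdmissibleKerrWave M a ψ →
            HasBallData M a R₁ ψ →
              -- (D1) first-order leaf energy: DRSR Cor. 3.1, first estimate / Moschidis Thm. 8.1
              (∃ C : ℝ, ∀ τ : ℝ, 1 ≤ τ →
                leafGradEnergy M a (scriHeight M a R₁) ψ τ ≤ ENNReal.ofReal (C * τ ^ (-2 : ℝ))) ∧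
              -- (D2) second-order leaf energy, improved decay: Cor. 3.1, second estimate /
              -- Moschidis Thm. 9.1, q = 2
              (∀ δ : ℝ, 0 < δ → ∃ C : ℝ, ∀ τ : ℝ, 1 ≤ τ →
                leafHessEnergy M a (scriHeight M a R₁) ψ τ ≤
                  ENNReal.ofReal (C * τ ^ (-4 + 2 * δ))) ∧
              -- (D3) a priori decay along each leaf: Cor. 3.1, third estimate; radiation field
              (∀ τ : ℝ, 1 ≤ τ → ∃ C₀ : ℝ, ∀ y ∈ (slice a (rPlus M a) : Set E3),
                ‖y‖ * |leafFun M a (scriHeight M a R₁) ψ τ y| ≤ C₀ ∧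
                  ‖y‖ * ‖fderiv ℝ (leafFun M a (scriHeight M a R₁) ψ τ) y‖ ≤ C₀))
    (hGN : ∀ (M a : ℝ), IsSubextremal M a → ∃ C : ℝ, 0 ≤ C ∧
        ∀ Φ : E3 → ℝ, ContDiffOn ℝ ∞ Φ (slice a (rPlus M a) : Set E3) →
          (∃ C₀ : ℝ, ∀ y ∈ (slice a (rPlus M a) : Set E3),
              ‖y‖ * |Φ y| ≤ C₀ ∧ ‖y‖ * ‖fderiv ℝ Φ y‖ ≤ C₀) →
            (∫⁻ y in (slice a (rPlus M a) : Set E3), ENNReal.ofReal (‖fderiv ℝ Φ y‖ ^ 2)) < ⊤ →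
            (∫⁻ y in (slice a (rPlus M a) : Set E3),
                ENNReal.ofReal (‖fderiv ℝ (fderiv ℝ Φ) y‖ ^ 2)) < ⊤ →
              ∀ y ∈ (slice a (rPlus M a) : Set E3),
                (Φ y) ^ 2 ≤ C *
                  (Real.sqrt (∫⁻ y in (slice a (rPlus M a) : Set E3),
                      ENNReal.ofReal (‖fderiv ℝ Φ y‖ ^ 2)).toReal *
                    Real.sqrt (∫⁻ y in (slice a (rPlus M a) : Set E3),
                      ENNReal.ofReal (‖fderiv ℝ (fderiv ℝ Φ) y‖ ^ 2)).toReal +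
                    (∫⁻ y in (slice a (rPlus M a) : Set E3),
                      ENNReal.ofReal (‖fderiv ℝ (fderiv ℝ Φ) y‖ ^ 2)).toReal)) :
    -- DRSR Cor. 3.1 (30) through the leaves `Σ̃_τ(h♯_{R₁})` (the leaf form; equivalent to the
    -- gr.S24 fact `drsr_wave_pointwise_decay_kerr`, `KerrPointwiseDecay.lean`)
    ∀ [Facts] [SliceFacts] (M a : ℝ), IsSubextremal M a →
      ∃ R₀ : ℝ, 0 < R₀ ∧ ∀ R₁ : ℝ, R₀ ≤ R₁ →
        ∀ ψ : region a (rPlus M a) → ℝ, Literature.Geometry.Lorentzian.IsAdmissibleKerrWave M a ψ →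
          HasBallData M a R₁ ψ → ∀ δ : ℝ, 0 < δ → ∀ R : ℝ, rPlus M a < R →
            ∃ C : ℝ, ∀ τ : ℝ, 1 ≤ τ →
              ∀ (y : E3) (hy : leafPoint (scriHeight M a R₁) τ y ∈ region a (rPlus M a)),
                radius a (leafPoint (scriHeight M a R₁) τ y) ≤ R →
                  |ψ ⟨leafPoint (scriHeight M a R₁) τ y, hy⟩| ≤ C * τ ^ (-(3 / 2 : ℝ) + δ) := by
  intro _ _ M a hMa
  obtain ⟨R₀, hR₀, hD'⟩ := hD M a hMa
  refine ⟨R₀, hMa.rPlus_pos.trans hR₀, fun R₁ hR₁ ψ hψ hball δ hδ R _hR ↦ ?_⟩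
  have hR₁' : rPlus M a < R₁ := hR₀.trans_le hR₁
  obtain ⟨⟨C₁, hC₁⟩, hD2, hD3⟩ := hD' R₁ hR₁ ψ hψ hball
  obtain ⟨C₂, hC₂⟩ := hD2 δ hδ
  obtain ⟨Cg, hCg, hGN'⟩ := hGN M a hMa
  set K : ℝ := Cg * (Real.sqrt (max C₁ 0) * Real.sqrt (max C₂ 0) + max C₂ 0) with hK
  have hK0 : 0 ≤ K := by positivity
  refine ⟨Real.sqrt K, fun τ hτ y hy _hyR ↦ ?_⟩
  have hτ0 : 0 ≤ τ := zero_le_one.trans hτ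
  set Φ : E3 → ℝ := leafFun M a (scriHeight M a R₁) ψ τ with hΦ
  have hS : y ∈ (slice a (rPlus M a) : Set E3) := ofTimeSpace_mem_region_iff.1 hy
  -- the hypotheses of (GN) for `Φ = Ψ_τ`
  have hreg : ContDiffOn ℝ ∞ Φ (slice a (rPlus M a) : Set E3) :=
    leafFun_contDiffOn hMa hR₁' hψ.1 τ
  have hdec := hD3 τ hτ
  set I₁ : ℝ≥0∞ := ∫⁻ y in (slice a (rPlus M a) : Set E3),
    ENNReal.ofReal (‖fderiv ℝ Φ y‖ ^ 2) with hI₁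
  set I₂ : ℝ≥0∞ := ∫⁻ y in (slice a (rPlus M a) : Set E3),
    ENNReal.ofReal (‖fderiv ℝ (fderiv ℝ Φ) y‖ ^ 2) with hI₂
  have hA := hC₁ τ hτ
  have hB := hC₂ τ hτ
  have hI₁le : I₁ ≤ ENNReal.ofReal (C₁ * τ ^ (-2 : ℝ)) :=
    (lintegral_fderiv_sq_le_leafGradEnergy M a _ ψ τ).trans hA
  have hI₂le : I₂ ≤ ENNReal.ofReal (C₂ * τ ^ (-4 + 2 * δ)) :=
    (lintegral_fderiv_fderiv_sq_le_leafHessEnergy M a _ ψ τ).trans hB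
  have hI₁fin : I₁ < ⊤ := lt_of_le_of_lt hI₁le ENNReal.ofReal_lt_top
  have hI₂fin : I₂ < ⊤ := lt_of_le_of_lt hI₂le ENNReal.ofReal_lt_top
  have hGNy := hGN' Φ hreg hdec hI₁fin hI₂fin y hS
  -- real bounds for the two integrals
  have hI₁r : I₁.toReal ≤ max C₁ 0 * τ ^ (-2 : ℝ) := toReal_le_max_mul_rpow hτ0 hI₁le
  have hI₂r : I₂.toReal ≤ max C₂ 0 * τ ^ (-4 + 2 * δ) := toReal_le_max_mul_rpow hτ0 hI₂le
  have hsq : (Φ y) ^ 2 ≤ K * τ ^ (-3 + 2 * δ) := by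
    calc (Φ y) ^ 2 ≤ Cg * (Real.sqrt I₁.toReal * Real.sqrt I₂.toReal + I₂.toReal) := hGNy
      _ ≤ Cg * (Real.sqrt (max C₁ 0 * τ ^ (-2 : ℝ)) * Real.sqrt (max C₂ 0 * τ ^ (-4 + 2 * δ)) +
            max C₂ 0 * τ ^ (-4 + 2 * δ)) := by
          gcongr
      _ ≤ Cg * ((Real.sqrt (max C₁ 0) * Real.sqrt (max C₂ 0) + max C₂ 0) * τ ^ (-3 + 2 * δ)) := by
          gcongr
          exact sqrt_mul_sqrt_add_le_rpow (le_max_right _ _) (le_max_right _ _) hδ hτ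
      _ = K * τ ^ (-3 + 2 * δ) := by rw [hK]; ring
  -- conclusion at the leaf point
  have hval : ψ ⟨leafPoint (scriHeight M a R₁) τ y, hy⟩ = Φ y :=
    (leafFun_apply_of_mem (scriHeight M a R₁) ψ τ hy).symm
  rw [hval, ← Real.sqrt_sq_eq_abs, ← sqrt_mul_rpow_eq hK0 hτ0]
  exact Real.sqrt_le_sqrt hsq

end assembly

/-- **DRSR's pointwise decay (coordinate form) from the energy decay estimates and the
Gagliardo–Nirenberg inequality on the leaves**: under the hypotheses (D) and (GN) of
`Kerr.drsr_corollary_3_1_scri_pointwise_decay_of_leafEnergy_decay` (documented in the section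
*The two analytic inputs* of this file), the named fact
`Literature.Geometry.Lorentzian.drsr_wave_pointwise_decay_kerr` of `KerrWaveDecay.lean` holds
(compose with `drsr_wave_pointwise_decay_kerr_of_corollary_3_1_scri_pointwise` of
`KerrPointwiseDecay.lean`). DRSR arXiv:1402.7034, §3.3 Cor. 3.1 (30); Moschidis arXiv:1509.08489,
§9.4. [cite: DafermosRodnianskiShlapentokhrothman2014, Cor. 3.1 (30); Moschidis2016 §9.4] -/
theorem _root_.Literature.Geometry.Lorentzian.drsr_wave_pointwise_decay_kerr_of_leafEnergy_decay
    (hD : ∀ [Facts] [SliceFacts] (M a : ℝ), IsSubextremal M a →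
        ∃ R₀ : ℝ, rPlus M a < R₀ ∧ ∀ R₁ : ℝ, R₀ ≤ R₁ →
          ∀ ψ : region a (rPlus M a) → ℝ, Literature.Geometry.Lorentzian.IsAdmissibleKerrWave M a ψ →
            HasBallData M a R₁ ψ →
              -- (D1) first-order leaf energy: DRSR Cor. 3.1, first estimate / Moschidis Thm. 8.1
              (∃ C : ℝ, ∀ τ : ℝ, 1 ≤ τ →
                leafGradEnergy M a (scriHeight M a R₁) ψ τ ≤ ENNReal.ofReal (C * τ ^ (-2 : ℝ))) ∧
              -- (D2) second-order leaf energy, improved decay: Cor. 3.1, second estimate /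
              -- Moschidis Thm. 9.1, q = 2
              (∀ δ : ℝ, 0 < δ → ∃ C : ℝ, ∀ τ : ℝ, 1 ≤ τ →
                leafHessEnergy M a (scriHeight M a R₁) ψ τ ≤
                  ENNReal.ofReal (C * τ ^ (-4 + 2 * δ))) ∧
              -- (D3) a priori decay along each leaf: Cor. 3.1, third estimate; radiation field
              (∀ τ : ℝ, 1 ≤ τ → ∃ C₀ : ℝ, ∀ y ∈ (slice a (rPlus M a) : Set E3),
                ‖y‖ * |leafFun M a (scriHeight M a R₁) ψ τ y| ≤ C₀ ∧
                  ‖y‖ * ‖fderiv ℝ (leafFun M a (scriHeight M a R₁) ψ τ) y‖ ≤ C₀))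
    (hGN : ∀ (M a : ℝ), IsSubextremal M a → ∃ C : ℝ, 0 ≤ C ∧
        ∀ Φ : E3 → ℝ, ContDiffOn ℝ ∞ Φ (slice a (rPlus M a) : Set E3) →
          (∃ C₀ : ℝ, ∀ y ∈ (slice a (rPlus M a) : Set E3),
              ‖y‖ * |Φ y| ≤ C₀ ∧ ‖y‖ * ‖fderiv ℝ Φ y‖ ≤ C₀) →
            (∫⁻ y in (slice a (rPlus M a) : Set E3), ENNReal.ofReal (‖fderiv ℝ Φ y‖ ^ 2)) < ⊤ →
            (∫⁻ y in (slice a (rPlus M a) : Set E3),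
                ENNReal.ofReal (‖fderiv ℝ (fderiv ℝ Φ) y‖ ^ 2)) < ⊤ →
              ∀ y ∈ (slice a (rPlus M a) : Set E3),
                (Φ y) ^ 2 ≤ C *
                  (Real.sqrt (∫⁻ y in (slice a (rPlus M a) : Set E3),
                      ENNReal.ofReal (‖fderiv ℝ Φ y‖ ^ 2)).toReal *
                    Real.sqrt (∫⁻ y in (slice a (rPlus M a) : Set E3),
                      ENNReal.ofReal (‖fderiv ℝ (fderiv ℝ Φ) y‖ ^ 2)).toReal +
                    (∫⁻ y in (slice a (rPlus M a) : Set E3),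
                      ENNReal.ofReal (‖fderiv ℝ (fderiv ℝ Φ) y‖ ^ 2)).toReal)) :
    Literature.Geometry.Lorentzian.drsr_wave_pointwise_decay_kerr :=
  drsr_wave_pointwise_decay_kerr_of_corollary_3_1_scri_pointwise
    (drsr_corollary_3_1_scri_pointwise_decay_of_leafEnergy_decay hD hGN)

end Kerr

end Literature.Geometry.Lorentzian

end
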